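import Summits.ValiantsHypothesis.ValiantsHypothesis.Theorems.FifoMatchingNNDivisionHardFaceBlindFewZones
import Summits.ValiantsHypothesis.ValiantsHypothesis.Theorems.FifoMatchingNNDivisionHardConePricing

/-!
# FACE-BLIND / GENERATOR form of the located read on the zonotope chapter of COR-VIRTUAL (crux `NNDivisionHard`, stmt-ValiantsHypothesis-21181) — part 4/5 — §13: ★★ THE CLIQUE-ZONE LAW — `CovZonoHard` settled for clique-zone families (dichotomy, both halves kernel)

Theorems-side port (val-port-1 g3, presser; desk RULING #357 (A); declaration texts VERBATIM) of val-idea-41 g3's crux workfile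
`Cruxes/NNDivisionHard/FaceBlind.lean` REV 7 @025cc0a9aa76 (sha16 588eb2e00eeb6290, 1599 l.; critic of record val-idea-crit-9 g2 VERDICT #43:
VERIFIED, KEEP §G(4)+(3), axioms standard), split by the 400-line cap into five chained modules `…FaceBlind` (§1–§10: typed statements,
`captureIffRefines`, `classZReduction`, `zonoEnemy_covers`) → `…FaceBlindRung` (§11: `zonoGenBlindAtDecided_holds`) → `…FaceBlindFewZones`
(§12: `fewZonesLaw_oneBlock`) → `…FaceBlindCliqueZone` (§13: `covZonoHard_cliqueZone`) → `…FaceBlindCount` (§14: `covZonoHardClique_holds`).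
DEDUP (desk: import, do not copy): the workfile's verbatim pastes of landed declarations are REPLACED by imports — `Jdir` :=
`ExposedFibre.Jdir` (✓ `…ExposedFibreRung`), `exists_large_avoid` / `exists_generic_comb` := `LowDim.*` (✓ `…LowDimFace`), `chi` / `uVec` / `uPush` /
`sum_uVec_chi` / `negRankOne_dot_corVec` / `sum_uPush_chi` := `ConePricing.*` (✓ `…ConePricing`); the pasted one-cut-rung lemmas of val-idea-40
(`admissible_blockDir`, `Admissible.dot_eq_zero_iff/dot_le/face_eq`, `exposedFibreRung_holds`, `exposedFibreDecided_holds`) keep their FOLDED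
statements here and are PROVED BY CITATION of the δ-unfolded landed theorems `ExposedFibre.*` (✓ p674xxx `…ExposedFibreRung`, val-port-4 g3 /
val-idea-40 g4).  Namespace `…Theorems.FifoMatching.FaceBlind` (workfile: `…Cruxes.NNDivisionHard.FaceBlind41`).

* `cliqueZone`, `three_pow_le_of_shattered` (BFPS functionals pushed forward along a SHATTERED block: `3^d ≤ (r+1)·2^d` on the passenger's own budget),
  `exists_shattered_block` (Sauer–Shelah via Mathlib `card_le_card_shatterer` / `card_shatterer_le_sum_vcDim`), `cliqueZoneDichotomy_holds`, `cliqueZone_decided`,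
  `two_pow_lt_of_three_pow_le`, ★★ `covZonoHard_cliqueZone` (modulo the explicit elementary count, discharged in part 5).

HONEST LABEL: helper rows for an OPEN crux (21181 `NNDivisionHard` OPEN; `CovZonoHard` OPEN for general zonotopal passengers); nothing here is a
summit statement; VP ≠ VNP is NOT proved.
-/

set_option autoImplicit false
set_option linter.dupNamespace false

noncomputable section
open Matrix Finset
open scoped Pointwise

namespace Summit.ValiantsHypothesis.ValiantsHypothesis.Theorems.FifoMatching.FaceBlind

open Literature.Barriers.PneNP (HasEFOfSize)
open Literature.Combinatorics.Optimization (corPolytopeGraph corVec)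
open Summit.ValiantsHypothesis.ValiantsHypothesis.Theorems.FifoMatching.ExposedFibre (Jdir)

variable {n m : ℕ}

/-! ## 13. ★★ THE CLIQUE-ZONE LAW — `CovZonoHard` SETTLED for clique-zone families (a dichotomy, both halves kernel)

Clique-zone zonotopal passengers `Z = w + Σ_i λ_i [0,1]·𝟙_{S_i}𝟙_{S_i}ᵀ` (distinct patterns `S_i`, lengths `λ_i > 0`).  DICHOTOMY:
FEW distinct zones ⇒ one-block avoidance + the Z♭ rung (`fewZonesLaw_oneBlock`) on the `COR + Z` budget; MANY distinct zones ⇒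
Sauer–Shelah (Mathlib `card_le_card_shatterer` + `card_shatterer_le_sum_vcDim`) gives a SHATTERED block `R`, `|R| = d + 1`, and the
BFPS functionals pushed forward along `R` (val-idea-44's `uPush`, pasted) exhibit the UDISJ pattern ON `Z` ITSELF
(`HasEFOfSize.three_pow_le`): `3^d ≤ (r+1)·2^d` on the PASSENGER's own budget.  No hypothesis on `Z` beyond an explicit elementary
count `(Σ_{k≤d} C(h,k))·C(h-t-1,t-1) < C(h-1,t-1)` (true for `d ≈ h/(m'² log h)`, all large `h`). -/

section CliqueZone
open Summit.ValiantsHypothesis.ValiantsHypothesis.Theorems.FifoMatching.LocatedFaceExposure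
open Summit.ValiantsHypothesis.ValiantsHypothesis.Theorems.FifoMatching.XcDivision
open Summit.ValiantsHypothesis.ValiantsHypothesis.Theorems.FifoMatching.ConePricing (chi uVec uPush sum_uVec_chi negRankOne_dot_corVec sum_uPush_chi)
-- `chi`, `corVec_top_apply`, `rankOne_dot_corVec`, `uVec`, `sum_uVec_chi`, `negRankOne_dot_corVec`, `uPush`, `sum_uPush_chi` (val-idea-44 g0,
-- `ConePricing44.lean` §5/§7) are the LANDED `ConePricing.*` (✓ p673503 `…ConePricing`) — reused by name, copies deleted.

/-- the clique zone of pattern `b` and length `λ`. -/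
def cliqueZone {h : ℕ} (lam : ℝ) (b : Fin h → Bool) : Fin h × Fin h → ℝ := lam • corVec (⊤ : SimpleGraph (Fin h)) b

/-- ★ SHATTERED BLOCK ⇒ UDISJ ON THE PASSENGER (new: val-idea-44's pushed-forward BFPS sandwich, re-proved on the subset-sum
representation with a translation `w`): if the patterns of a clique-zone family realise every pattern on a block `ρ : Fin (d+1) ↪ [h]`,
then `HasEFOfSize Z r → 3^d ≤ (r+1)·2^d`. -/
theorem three_pow_le_of_shattered {h d M : ℕ} (pat : Fin M → (Fin h → Bool)) (lam : Fin M → ℝ) (hlam : ∀ i, 0 < lam i)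
    (w : Fin h × Fin h → ℝ) (ρ : Fin (d + 1) ↪ Fin h) (hsh : ∀ s : Fin (d + 1) → Bool, ∃ i, ∀ j, pat i (ρ j) = s j)
    {r : ℕ} (hEF : HasEFOfSize (convexHull ℝ (Set.range (subsetSum (fun i => cliqueZone (lam i) (pat i)) w))) r) :
    3 ^ d ≤ (r + 1) * 2 ^ d := by
  classical
  set gen : Fin M → (Fin h × Fin h → ℝ) := fun i => cliqueZone (lam i) (pat i) with hgen
  choose isel hisel using fun a : Finset (Fin d) => hsh (Fin.cons true fun i => decide (i ∈ a))
  have hzone : ∀ (a : Finset (Fin d)) (i : Fin M),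
      (fun x : Fin h × Fin h => -(uPush ρ a x.1 * uPush ρ a x.2)) ⬝ᵥ gen i
        = lam i * -((∑ j, uVec a j * chi (pat i) (ρ j)) ^ 2) := by
    intro a i
    simp only [hgen, cliqueZone]
    rw [dotProduct_smul, smul_eq_mul, negRankOne_dot_corVec, sum_uPush_chi]
  have hslack : ∀ a a' : Finset (Fin d),
      (fun x : Fin h × Fin h => -(uPush ρ a x.1 * uPush ρ a x.2)) ⬝ᵥ gen (isel a')
        = lam (isel a') * -((((a ∩ a').card : ℝ) - 1) ^ 2) := by
    intro a a'
    rw [hzone]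
    have : ∑ j, uVec a j * chi (pat (isel a')) (ρ j)
        = ∑ j, uVec a j * chi (Fin.cons true (fun i => decide (i ∈ a')) : Fin (d + 1) → Bool) j :=
      Finset.sum_congr rfl fun j _ => by simp only [chi, hisel a' j]
    rw [this, sum_uVec_chi]
  have hpt : ∀ a : Finset (Fin d), subsetSum gen w {isel a} = w + gen (isel a) := fun a => by
    simp [subsetSum]
  refine hEF.three_pow_le (fun a => subsetSum gen w {isel a}) (fun a => subset_convexHull ℝ _ ⟨{isel a}, rfl⟩)
    (fun a x => -(uPush ρ a x.1 * uPush ρ a x.2)) (fun a => (fun x => -(uPush ρ a x.1 * uPush ρ a x.2)) ⬝ᵥ w) ?_ ?_ ?_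
  · -- validity on the whole zonotope
    intro a
    refine dot_le_of_mem_convexHull _ _ _ ?_
    rintro _ ⟨S, rfl⟩
    rw [dot_subsetSum]
    have : ∑ i ∈ S, (fun x : Fin h × Fin h => -(uPush ρ a x.1 * uPush ρ a x.2)) ⬝ᵥ gen i ≤ 0 :=
      Finset.sum_nonpos fun i _ => by
        rw [hzone]
        exact mul_nonpos_of_nonneg_of_nonpos (hlam i).le (neg_nonpos.mpr (sq_nonneg _))
    linarith
  · intro a a' hlt hcard
    rw [hpt, dotProduct_add, hslack, hcard] at hlt
    norm_num at hlt
  · intro a a' hab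
    rw [hpt, dotProduct_add, hslack, Finset.disjoint_iff_inter_eq_empty.mp hab]
    have := hlam (isel a')
    norm_num
    linarith

/-- ★ MANY DISTINCT PATTERNS ⇒ A SHATTERED BLOCK (Sauer–Shelah, Mathlib): `Σ_{k ≤ d} C(h,k) < M` distinct patterns realise every
pattern on some block of size `d + 1`. -/
theorem exists_shattered_block {h d M : ℕ} (pat : Fin M → (Fin h → Bool)) (hinj : Function.Injective pat)
    (hM : ∑ k ∈ Finset.Iic d, h.choose k < M) :
    ∃ ρ : Fin (d + 1) ↪ Fin h, ∀ s : Fin (d + 1) → Bool, ∃ i, ∀ j, pat i (ρ j) = s j := by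
  classical
  let supp : Fin M → Finset (Fin h) := fun i => Finset.univ.filter fun p => pat i p = true
  have hsupp_inj : Function.Injective supp := by
    intro i j hij
    apply hinj
    funext p
    have := Finset.ext_iff.1 hij p
    simp only [supp, Finset.mem_filter, Finset.mem_univ, true_and] at this
    exact Bool.eq_iff_iff.2 this
  set 𝒜 : Finset (Finset (Fin h)) := Finset.univ.image supp with h𝒜
  have hcard𝒜 : 𝒜.card = M := by
    rw [h𝒜, Finset.card_image_of_injective _ hsupp_inj, Finset.card_univ, Fintype.card_fin]
  have hM1 : 1 ≤ M := by
    have : h.choose 0 ≤ ∑ k ∈ Finset.Iic d, h.choose k :=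
      Finset.single_le_sum (f := fun k => h.choose k) (fun _ _ => Nat.zero_le _) (Finset.mem_Iic.2 (Nat.zero_le d))
    simp at this
    omega
  have hne : 𝒜.Nonempty := by
    rw [← Finset.card_pos, hcard𝒜]; exact hM1
  have hshne : 𝒜.shatterer.Nonempty := ⟨∅, Finset.mem_shatterer.2 (Finset.shatters_empty.2 hne)⟩
  -- vcDim ≥ d + 1
  have hvc : d + 1 ≤ 𝒜.vcDim := by
    by_contra hlt
    push Not at hlt
    have h1 : M ≤ ∑ k ∈ Finset.Iic 𝒜.vcDim, h.choose k := by
      have := (Finset.card_le_card_shatterer 𝒜).trans (Finset.card_shatterer_le_sum_vcDim (𝒜 := 𝒜))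
      rw [hcard𝒜, Fintype.card_fin] at this
      exact this
    have h2 : ∑ k ∈ Finset.Iic 𝒜.vcDim, h.choose k ≤ ∑ k ∈ Finset.Iic d, h.choose k :=
      Finset.sum_le_sum_of_subset (Finset.Iic_subset_Iic.2 (by omega))
    omega
  obtain ⟨s, hs, hsup⟩ := Finset.exists_mem_eq_sup 𝒜.shatterer hshne Finset.card
  have hscard : d + 1 ≤ s.card := by
    have : 𝒜.vcDim = s.card := hsup
    omega
  obtain ⟨R, hRs, hRcard⟩ := Finset.exists_subset_card_eq hscard
  have hR : 𝒜.Shatters R := (Finset.mem_shatterer.1 hs).mono_right hRs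
  let ρ : Fin (d + 1) ↪ Fin h := (R.orderEmbOfFin hRcard).toEmbedding
  have hρR : ∀ j, ρ j ∈ R := fun j => Finset.orderEmbOfFin_mem R hRcard j
  refine ⟨ρ, fun sgn => ?_⟩
  let t : Finset (Fin h) := (Finset.univ.filter fun j => sgn j = true).map ρ
  have ht : t ⊆ R := by
    intro p hp
    obtain ⟨j, -, rfl⟩ := Finset.mem_map.1 hp
    exact hρR j
  obtain ⟨u, hu, hRu⟩ := hR ht
  obtain ⟨i, -, rfl⟩ := Finset.mem_image.1 hu
  refine ⟨i, fun j => ?_⟩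
  have h1 : ρ j ∈ R ∩ supp i ↔ ρ j ∈ t := by rw [hRu]
  rw [Finset.mem_inter] at h1
  simp only [hρR j, true_and, supp, Finset.mem_filter, Finset.mem_univ] at h1
  have h2 : ρ j ∈ t ↔ sgn j = true := by
    simp only [t, Finset.mem_map', Finset.mem_filter, Finset.mem_univ, true_and]
  exact Bool.eq_iff_iff.2 (h1.trans h2)

/-- ★★ THE CLIQUE-ZONE DICHOTOMY (statement): for clique-zone zonotopal passengers with distinct patterns and positive lengths,
under the elementary count `(Σ_{k≤d} C(h,k))·C(h-t-1,t-1) < C(h-1,t-1)`: EITHER the `COR + Z` budget pays the Z♭ rate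
`(3/2)^{m'-1} ≤ 2(r₂+1)` OR the passenger's own budget pays UDISJ on a shattered block `3^d ≤ (r₁+1)·2^d`. -/
def CliqueZoneDichotomy : Prop :=
  ∀ (h m' t d M : ℕ) (pat : Fin M → (Fin h → Bool)) (lam : Fin M → ℝ) (w : Fin h × Fin h → ℝ) (r₁ r₂ : ℕ),
    2 ≤ m' → 1 ≤ t → m' * t ≤ h → Function.Injective pat → (∀ i, 0 < lam i) →
    (∑ k ∈ Finset.Iic d, h.choose k) * Nat.choose (h - t - 1) (t - 1) < Nat.choose (h - 1) (t - 1) →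
    HasEFOfSize (convexHull ℝ (Set.range (subsetSum (fun i => cliqueZone (lam i) (pat i)) w))) r₁ →
    HasEFOfSize (corPolytopeGraph (⊤ : SimpleGraph (Fin h)) +
      convexHull ℝ (Set.range (subsetSum (fun i => cliqueZone (lam i) (pat i)) w))) r₂ →
      (3 / 2 : ℝ) ^ (m' - 1) ≤ 2 * (r₂ + 1) ∨ 3 ^ d ≤ (r₁ + 1) * 2 ^ d

/-- ★★ PROVED. -/
theorem cliqueZoneDichotomy_holds : CliqueZoneDichotomy := by
  intro h m' t d M pat lam w r₁ r₂ hm ht hh hinj hlam hcount hEF₁ hEF₂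
  by_cases hfew : M * Nat.choose (h - t - 1) (t - 1) < Nat.choose (h - 1) (t - 1)
  · exact Or.inl (fewZonesLaw_oneBlock h m' t M _ w r₂ hm ht hh hfew hEF₂)
  · right
    push Not at hfew
    have hM : ∑ k ∈ Finset.Iic d, h.choose k < M := by
      by_contra hle
      push Not at hle
      have := Nat.mul_le_mul_right (Nat.choose (h - t - 1) (t - 1)) hle
      omega
    obtain ⟨ρ, hρ⟩ := exists_shattered_block pat hinj hM
    exact three_pow_le_of_shattered pat lam hlam w ρ hρ hEF₁

/-- ★★ COROLLARY — THE CLIQUE-ZONE CHAPTER OF COR-MINKOWSKI IN THE CRUX'S SHAPE: with `L = (log₂ h + C)^C`, `m' = 2L + 4`,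
`d = 2L + 3` and any block size `t ≥ 1` with `m'·t ≤ h` satisfying the count, a clique-zone passenger budgeted by `r` (itself AND
with `COR(K_h)`) has `2^L < r`.  (`CovZonoHard` restricted to clique-zone families follows: a COVERING family is never in the few
branch.)  The count holds for all `h ≥ h₀(C)` at `t = h / m'` (ratio `≈ e^{h/m'^2}` vs `h^{2L+4}`); that asymptotic is prose. -/
theorem cliqueZone_decided (C h t M : ℕ) (pat : Fin M → (Fin h → Bool)) (lam : Fin M → ℝ) (w : Fin h × Fin h → ℝ) (r : ℕ)
    (ht : 1 ≤ t) (hh : (2 * (Nat.log 2 h + C) ^ C + 4) * t ≤ h) (hinj : Function.Injective pat) (hlam : ∀ i, 0 < lam i)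
    (hcount : (∑ k ∈ Finset.Iic (2 * (Nat.log 2 h + C) ^ C + 3), h.choose k) * Nat.choose (h - t - 1) (t - 1)
      < Nat.choose (h - 1) (t - 1))
    (hEF₁ : HasEFOfSize (convexHull ℝ (Set.range (subsetSum (fun i => cliqueZone (lam i) (pat i)) w))) r)
    (hEF₂ : HasEFOfSize (corPolytopeGraph (⊤ : SimpleGraph (Fin h)) +
      convexHull ℝ (Set.range (subsetSum (fun i => cliqueZone (lam i) (pat i)) w))) r) :
    2 ^ ((Nat.log 2 h + C) ^ C) < r := by
  set L := (Nat.log 2 h + C) ^ C with hLdef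
  have hL : 1 ≤ L := one_le_L h C
  have h1 : (2 : ℝ) ≤ 2 ^ L := by
    calc (2 : ℝ) = 2 ^ 1 := by norm_num
      _ ≤ 2 ^ L := pow_le_pow_right₀ (by norm_num) hL
  have h2 : (2 : ℝ) ^ L ≤ (9 / 4) ^ L := pow_le_pow_left₀ (by norm_num) (by norm_num) L
  have key : (3 / 2 : ℝ) ^ (2 * L + 3) = (9 / 4) ^ L * (27 / 8) := by
    rw [pow_add, pow_mul]; norm_num
  rcases cliqueZoneDichotomy_holds h (2 * L + 4) t (2 * L + 3) M pat lam w r r (by omega) ht hh hinj hlam hcount hEF₁ hEF₂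
    with hdec | hdec
  · have hm : 2 * L + 4 - 1 = 2 * L + 3 := by omega
    rw [hm, key] at hdec
    have hlt : (2 : ℝ) ^ L < r := by linarith
    exact_mod_cast hlt
  · -- `3^(2L+3) ≤ (r+1)·2^(2L+3)` ⇒ `(3/2)^(2L+3) ≤ r + 1`
    have hR : (3 : ℝ) ^ (2 * L + 3) ≤ (r + 1) * 2 ^ (2 * L + 3) := by exact_mod_cast hdec
    have h2pos : (0 : ℝ) < 2 ^ (2 * L + 3) := by positivity
    have hmain : (3 / 2 : ℝ) ^ (2 * L + 3) ≤ r + 1 := by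
      rw [div_pow, div_le_iff₀ h2pos]
      exact hR
    rw [key] at hmain
    have hlt : (2 : ℝ) ^ L < r := by nlinarith
    exact_mod_cast hlt

/-- arithmetic: `3^(2L+3) ≤ (r+1)·2^(2L+3)` with `L ≥ 1` forces `2^L < r`. -/
theorem two_pow_lt_of_three_pow_le {L r : ℕ} (hL : 1 ≤ L) (hdec : 3 ^ (2 * L + 3) ≤ (r + 1) * 2 ^ (2 * L + 3)) :
    2 ^ L < r := by
  have h1 : (2 : ℝ) ≤ 2 ^ L := by
    calc (2 : ℝ) = 2 ^ 1 := by norm_num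
      _ ≤ 2 ^ L := pow_le_pow_right₀ (by norm_num) hL
  have h2 : (2 : ℝ) ^ L ≤ (9 / 4) ^ L := pow_le_pow_left₀ (by norm_num) (by norm_num) L
  have key : (3 / 2 : ℝ) ^ (2 * L + 3) = (9 / 4) ^ L * (27 / 8) := by
    rw [pow_add, pow_mul]; norm_num
  have hR : (3 : ℝ) ^ (2 * L + 3) ≤ (r + 1) * 2 ^ (2 * L + 3) := by exact_mod_cast hdec
  have h2pos : (0 : ℝ) < 2 ^ (2 * L + 3) := by positivity
  have hmain : (3 / 2 : ℝ) ^ (2 * L + 3) ≤ r + 1 := by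
    rw [div_pow, div_le_iff₀ h2pos]
    exact hR
  rw [key] at hmain
  have hlt : (2 : ℝ) ^ L < r := by nlinarith
  exact_mod_cast hlt

/-- ★★ `CovZonoHard` FOR CLIQUE-ZONE FAMILIES (the conjecture of §8 restricted to clique zones, PROVED modulo the explicit count):
a clique-zone family COVERING level `2L + 4` cannot be in the few branch (`exists_oneBlock_avoiding` would produce an avoiding
surjection), so Sauer–Shelah + the pushed BFPS sandwich price the passenger ALONE: `HasEFOfSize Z r → 2^L < r`.  No `COR + Z`
budget is used. -/
theorem covZonoHard_cliqueZone (C h t M : ℕ) (pat : Fin M → (Fin h → Bool)) (lam : Fin M → ℝ) (w : Fin h × Fin h → ℝ) (r : ℕ)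
    (ht : 1 ≤ t) (hh : (2 * (Nat.log 2 h + C) ^ C + 4) * t ≤ h) (hinj : Function.Injective pat) (hlam : ∀ i, 0 < lam i)
    (hcount : (∑ k ∈ Finset.Iic (2 * (Nat.log 2 h + C) ^ C + 3), h.choose k) * Nat.choose (h - t - 1) (t - 1)
      < Nat.choose (h - 1) (t - 1))
    (hcov : Covers h (2 * (Nat.log 2 h + C) ^ C + 4) (fun i => cliqueZone (lam i) (pat i)))
    (hEF : HasEFOfSize (convexHull ℝ (Set.range (subsetSum (fun i => cliqueZone (lam i) (pat i)) w))) r) :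
    2 ^ ((Nat.log 2 h + C) ^ C) < r := by
  set L := (Nat.log 2 h + C) ^ C with hLdef
  have hL : 1 ≤ L := one_le_L h C
  have hmany : ¬ (M * Nat.choose (h - t - 1) (t - 1) < Nat.choose (h - 1) (t - 1)) := by
    intro hfew
    obtain ⟨β, ρ, hρ, hZ⟩ := exists_oneBlock_avoiding h (2 * L + 4) t M (by omega) ht hh _ hfew
    obtain ⟨i, hcap, hoff⟩ := hcov β (fun j => ⟨ρ j, hρ j⟩)
    exact hoff (hZ i hcap)
  have hM : ∑ k ∈ Finset.Iic (2 * L + 3), h.choose k < M := by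
    by_contra hle
    push Not at hle
    have := Nat.mul_le_mul_right (Nat.choose (h - t - 1) (t - 1)) hle
    omega
  obtain ⟨ρ, hρ⟩ := exists_shattered_block pat hinj hM
  exact two_pow_lt_of_three_pow_le hL (three_pow_le_of_shattered pat lam hlam w ρ hρ hEF)

end CliqueZone

end Summit.ValiantsHypothesis.ValiantsHypothesis.Theorems.FifoMatching.FaceBlind

end
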